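import Literature.NumberTheory.EllipticCurves.IsogenyMinimalDiscriminantModTwelveProofs
import HarnessLib

/-!
# `pˢ · ord_p Δ_min(E) ≡ ord_p Δ_min(E') (mod 12)` with the EXPLICIT exponent `s = v_p(deg φ)` for a
# CYCLIC `ℚ`-isogeny, and the dichotomy `ord_p Δ_min(E') ≡ ord_p Δ_min(E)` or `≡ p · ord_p Δ_min(E)`
# for an ARBITRARY one (Dokchitser–Dokchitser 2015, §3 Thm. 6, general degree) — proofs only

`Proofs` file (theorems only: no definition, no named fact, no instance), topic
`NumberTheory/EllipticCurves`; sequel of `IsogenyMinimalDiscriminantModTwelveProofs` (same mechanism: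
the discharged clause `l ≠ p` of op. cit. Thm. 5.1 (1) on the prime-to-`p` factor through a global
minimal model, Coates' lemma `Isogeny.exists_Δ_pow_eq_mul_pow_twelve'` on the `p`-part), which records
`∃ s, pˢ·ord_p Δ_min(W) ≡ ord_p Δ_min(W') (mod 12)` for `W ∼ W'`. Here:

* `Isogeny.pow_factorization_mul_padicValInt_minimalDiscriminantInt_modEq_twelve_of_isCyclic` — for a
  CYCLIC `φ : W → W'` (globally minimal, `p ≥ 5`, `0 ≤ ord_p j(W)`) the exponent is EXPLICIT:
  **`p^{v_p(deg φ)} · ord_p Δ_min(W) ≡ ord_p Δ_min(W') (mod 12)`** — Dokchitser–Dokchitser's Thm. 6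
  (`δ' ≡ p·δ (mod 12)` for a `p`-isogeny) for every cyclic degree.
* `padicValInt_minimalDiscriminantInt_modEq_or_modEq_mul_of_isIsogenous` — for ANY `W ∼ W'`:
  **`ord_p Δ_min(W') ≡ ord_p Δ_min(W)` or `ord_p Δ_min(W') ≡ p · ord_p Δ_min(W) (mod 12)`**, because
  `p² ≡ 1 (mod 12)` for `p ≥ 5`. With the semistability defect `e = 12/gcd(12, ord_p Δ_min)`: on the
  locus `e ∣ p − 1` (type (G)) both alternatives coincide (`δ' ≡ δ`), on `e ∣ p + 1`, `e ∤ p − 1`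
  (the `(t′)`/potentially supersingular locus) the second reads `δ' ≡ −δ`, i.e. the Kodaira swap
  `II ↔ II*, III ↔ III*, IV ↔ IV*` of op. cit. Cor. 8 / Table 1 — which of the two occurs is decided
  by the parity of `v_p` of the cyclic degree (first theorem).

Nothing here touches `p ∈ {2, 3}` (Coates' lemma needs a kernel of order prime to `6`).

## References
* [DokchitserDokchitser2015LocalInvariants] T. Dokchitser, V. Dokchitser, *Local invariants of
  isogenous elliptic curves*, Trans. Amer. Math. Soc. 367 (2015) = arXiv:1208.5519: §2 Thm. 3,
  §3 Thm. 6, Cor. 8, Table 1, §5 Thm. 5.1 (1).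
* [SilvermanAEC2009] J. H. Silverman, *The Arithmetic of Elliptic Curves*, 2nd ed.: Cor. III.4.11,
  Prop. III.4.12, Cor. VIII.8.3.
-/

noncomputable section

open scoped Classical

open Finset

universe u

namespace WeierstrassCurve

namespace Isogeny

variable {K : Type u} [Field K] {W W' : WeierstrassCurve K}

/-- A cyclic kernel in generator form (private bookkeeping, as in the prequel): for `φ` with cyclic
kernel of order `n = #ker φ > 1` there is an affine `P = (x₀, y₀)` of exact order `n` with
`ker φ = {k • P : k < n}`. [folklore] -/
private theorem exists_generator_of_isCyclic' (φ : Isogeny W W') (hφ : φ.IsCyclic)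
    (h1 : 1 < φ.degree) :
    ∃ (x₀ y₀ : AlgebraicClosure K)
      (h : (W.baseChange (AlgebraicClosure K)).toAffine.Nonsingular x₀ y₀),
      (φ.degree : ℤ) • Affine.Point.some x₀ y₀ h = 0 ∧
      (∀ k : ℕ, 0 < k → k < φ.degree → (k : ℤ) • Affine.Point.some x₀ y₀ h ≠ 0) ∧
      ∀ Q : W.geomPoints, Q ∈ φ.toAddMonoidHom.ker ↔
        Q ∈ (range φ.degree).image fun k : ℕ => (k : ℤ) • Affine.Point.some x₀ y₀ h := by
  haveI : IsAddCyclic φ.toAddMonoidHom.ker := hφ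
  obtain ⟨g, hg⟩ := IsAddCyclic.exists_ofOrder_eq_natCard (α := φ.toAddMonoidHom.ker)
  set P : W.geomPoints := (g : W.geomPoints) with hPdef
  have hdeg : addOrderOf P = φ.degree := by
    rw [hPdef, AddSubgroup.addOrderOf_coe, hg]; rfl
  have hP0 : P ≠ 0 := by
    intro h0
    rw [h0, addOrderOf_zero] at hdeg
    omega
  have hordP : (φ.degree : ℤ) • P = 0 := by
    rw [natCast_zsmul, ← hdeg]; exact addOrderOf_nsmul_eq_zero P
  have hminP : ∀ k : ℕ, 0 < k → k < φ.degree → (k : ℤ) • P ≠ 0 := by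
    intro k hk0 hk hzero
    rw [natCast_zsmul] at hzero
    have := addOrderOf_le_of_nsmul_eq_zero hk0 hzero
    omega
  have hzm : AddSubgroup.zmultiples P = φ.toAddMonoidHom.ker := by
    refine AddSubgroup.eq_of_le_of_card_ge (AddSubgroup.zmultiples_le_of_mem g.2) ?_
    rw [Nat.card_zmultiples, hdeg]
    rfl
  have hkerP : ∀ Q : W.geomPoints, Q ∈ φ.toAddMonoidHom.ker ↔
      ∃ k : ℕ, k < φ.degree ∧ (k : ℤ) • P = Q := by
    intro Q
    rw [← hzm, AddSubgroup.mem_zmultiples_iff]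
    constructor
    · rintro ⟨k, rfl⟩
      have hn0 : (φ.degree : ℤ) ≠ 0 := by exact_mod_cast φ.degree_pos.ne'
      have h0 : 0 ≤ k % (φ.degree : ℤ) := Int.emod_nonneg _ hn0
      have h1 : k % (φ.degree : ℤ) < (φ.degree : ℤ) :=
        Int.emod_lt_of_pos _ (by exact_mod_cast φ.degree_pos)
      refine ⟨(k % (φ.degree : ℤ)).toNat, by omega, ?_⟩
      rw [Int.toNat_of_nonneg h0, ← hdeg, mod_addOrderOf_zsmul]
    · rintro ⟨k, -, rfl⟩
      exact ⟨(k : ℤ), rfl⟩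
  obtain ⟨x₀, y₀, h, hP⟩ : ∃ (x₀ y₀ : AlgebraicClosure K)
      (h : (W.baseChange (AlgebraicClosure K)).toAffine.Nonsingular x₀ y₀),
      P = Affine.Point.some x₀ y₀ h := by
    rcases hgP : P with _ | ⟨x₀, y₀, h⟩
    · exact (hP0 hgP).elim
    · exact ⟨x₀, y₀, h, rfl⟩
  refine ⟨x₀, y₀, h, ?_, ?_, ?_⟩
  · have := hordP
    rw [hP] at this
    exact this
  · intro k hk0 hk
    have := hminP k hk0 hk
    rw [hP] at this
    exact this
  · intro Q
    rw [hkerP Q]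
    constructor
    · rintro ⟨k, hk, hkQ⟩
      rw [hP] at hkQ
      exact (Finset.mem_image (β := (W.baseChange (AlgebraicClosure K)).toAffine.Point)).mpr
        ⟨k, Finset.mem_range.mpr hk, hkQ⟩
    · intro hQ
      obtain ⟨k, hk, hkQ⟩ :=
        (Finset.mem_image (β := (W.baseChange (AlgebraicClosure K)).toAffine.Point)).mp hQ
      refine ⟨k, Finset.mem_range.mp hk, ?_⟩
      rw [hP]
      exact hkQ

/-- **Dokchitser–Dokchitser 2015, §3 Thm. 6 for a CYCLIC `ℚ`-isogeny of arbitrary degree, explicit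
exponent.** For globally minimal elliptic curves `W, W'/ℚ`, a cyclic `ℚ`-isogeny `φ : W → W'`, a prime
`p ≥ 5` with `0 ≤ ord_p j(W)`:
`p^{v_p(deg φ)} · ord_p Δ_min(W) ≡ ord_p Δ_min(W') (mod 12)`. Proof as in the prequel (there with the
exponent hidden behind `∃`): `deg φ = pˢ·m` with `s = v_p(deg φ)`, `p ∤ m`; `φ = λ ∘ ψ` with
`ψ : W → W''` cyclic of degree `pˢ` (kernel `ker φ ∩ W[pˢ]`) and `deg λ = m`; the discharged clause
`l ≠ p` of Thm. 5.1 (1) on `λ` read from a global minimal model `C • W''`, and Coates' lemma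
`Δ(W)^{pˢ} = Δ(W'')·c¹²` on `ψ`. [cite: DokchitserDokchitser2015LocalInvariants, §3 Thm. 6 with §2 Thm. 3 (Coates) and §5 Thm. 5.1 (1)]
[cite: SilvermanAEC2009, Cor. III.4.11, Prop. III.4.12, Cor. VIII.8.3] -/
theorem pow_factorization_mul_padicValInt_minimalDiscriminantInt_modEq_twelve_of_isCyclic
    {W W' : WeierstrassCurve ℚ} [W.IsElliptic] [W'.IsElliptic] [W.IsGloballyMinimal]
    [W'.IsGloballyMinimal] (φ : Isogeny W W') (hφ : φ.IsCyclic) {p : ℕ} (hp : p.Prime)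
    (hp5 : 5 ≤ p) (hj : 0 ≤ padicValRat p W.j) :
    (p : ℤ) ^ (φ.degree.factorization p) * (padicValInt p W.minimalDiscriminantInt : ℤ) ≡
      (padicValInt p W'.minimalDiscriminantInt : ℤ) [ZMOD 12] := by
  classical
  haveI := Fact.mk hp
  set n := φ.degree with hn
  have hn0 : n ≠ 0 := φ.degree_pos.ne'
  by_cases hpn : p ∣ n
  swap
  · -- degree prime to `p`: exponent `0`, the discharged clause `l ≠ p`
    rw [Nat.factorization_eq_zero_of_not_dvd hpn, pow_zero, one_mul,
      Literature.NumberTheory.EllipticCurves.dokchitser_padicValInt_minimalDiscriminantInt_eq_of_isogeny_of_not_dvd_degree_holds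
        W W' φ p hp hpn hj]
  set s := n.factorization p with hs
  have hps : p ^ s ∣ n := Nat.ordProj_dvd n p
  have hcop : Nat.Coprime p (n / p ^ s) := Nat.coprime_ordCompl hp hn0
  have hs1 : 1 ≤ s := (hp.dvd_iff_one_le_factorization hn0).mp hpn
  have hps0 : 0 < p ^ s := pow_pos hp.pos s
  have h1n : 1 < p ^ s := Nat.one_lt_pow (by omega) hp.one_lt
  -- `ψ : W → W''` cyclic of degree `pˢ`, `φ = λ ∘ ψ`, `deg λ = n / pˢ`
  obtain ⟨W'', hW'', ψ, hψc, hψdeg, hψker⟩ := φ.exists_isCyclic_degree_eq_of_dvd hφ hps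
  haveI := hW''
  have hkerle : ∀ P : W.geomPoints, ψ P = 0 → φ P = 0 := by
    intro P hP
    have hmem : P ∈ ψ.toAddMonoidHom.ker := hP
    rw [hψker] at hmem
    exact (AddSubgroup.mem_inf.mp hmem).1
  obtain ⟨lam, hlam⟩ := ψ.exists_eq_comp_of_ker_le φ (degree_eq_deg ψ).ge hkerle
  have hcard : n = lam.degree * p ^ s := by
    have h1 := AddMonoidHom.natCard_ker_comp_of_surjective lam.toAddMonoidHom ψ.toAddMonoidHom
      ψ.surjective
    have h2 : (lam.toAddMonoidHom.comp ψ.toAddMonoidHom).ker = φ.toAddMonoidHom.ker := by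
      ext P
      simp only [AddMonoidHom.mem_ker, AddMonoidHom.coe_comp, Function.comp_apply,
        coe_toAddMonoidHom, hlam P]
    rw [h2] at h1
    rw [← hψdeg]
    exact h1
  have hlamdeg : lam.degree = n / p ^ s := by
    rw [eq_comm]
    exact Nat.div_eq_of_eq_mul_left hps0 hcard
  have hndvd : ¬ p ∣ lam.degree := by
    rw [hlamdeg]
    exact (Nat.Prime.coprime_iff_not_dvd hp).mp hcop
  -- global minimal model of `W''`, transported `λ₂ : C • W'' → W'`, clause `l ≠ p`
  obtain ⟨C, hC⟩ := hasGlobalMinimalModel_rat_holds W''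
  haveI := hC
  obtain ⟨lam₂, hlam₂⟩ : ∃ lam₂ : Isogeny (C • W'') W', lam₂.degree = lam.degree := by
    have h := lam.exists_degree_eq_of_smul C (1 : VariableChange ℚ)
    rwa [one_smul] at h
  have hndvd₂ : ¬ p ∣ lam₂.degree := by rw [hlam₂]; exact hndvd
  have hj'' : 0 ≤ padicValRat p W''.j :=
    Literature.NumberTheory.EllipticCurves.padicValRat_j_nonneg_of_isogeny ψ hp hj
  have hjC : 0 ≤ padicValRat p (C • W'').j := by rw [variableChange_j]; exact hj''
  have hsib :=
    Literature.NumberTheory.EllipticCurves.dokchitser_padicValInt_minimalDiscriminantInt_eq_of_isogeny_of_not_dvd_degree_holds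
      (C • W'') W' lam₂ p hp hndvd₂ hjC
  -- Coates on `ψ`
  obtain ⟨x₀, y₀, h, hord, hmin, hker⟩ :=
    ψ.exists_generator_of_isCyclic' hψc (by rw [hψdeg]; exact h1n)
  rw [hψdeg] at hord hmin hker
  have hodd : p ^ s = 2 * (p ^ s / 2) + 1 := by
    have hodd' : Odd (p ^ s) := (hp.odd_of_ne_two (by omega)).pow
    obtain ⟨m, hm⟩ := hodd'
    omega
  have h3 : Nat.Coprime 3 (p ^ s) := by
    apply Nat.Coprime.pow_right
    rw [Nat.coprime_primes Nat.prime_three hp]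
    omega
  obtain ⟨c, hc⟩ := ψ.exists_Δ_pow_eq_mul_pow_twelve' h hodd h3 h1n hord hmin hker
  have hΔW : W.Δ ≠ 0 := W.isUnit_Δ.ne_zero
  have hΔC : (C • W'').Δ ≠ 0 := (C • W'').isUnit_Δ.ne_zero
  have hu0 : ((C.u : ℚˣ) : ℚ) ≠ 0 := C.u.ne_zero
  have hΔ'' : W''.Δ = ((C.u : ℚˣ) : ℚ) ^ 12 * (C • W'').Δ := by
    rw [variableChange_Δ, Units.val_inv_eq_inv_val, ← mul_assoc, ← mul_pow,
      mul_inv_cancel₀ hu0, one_pow, one_mul]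
  have hc' : W.Δ ^ (p ^ s) = (C • W'').Δ * (((C.u : ℚˣ) : ℚ) * c) ^ 12 := by
    rw [hc, hΔ'']; ring
  have hc0 : c ≠ 0 := by
    rintro rfl
    rw [zero_pow (by norm_num), mul_zero] at hc
    exact pow_ne_zero _ hΔW hc
  have huc0 : ((C.u : ℚˣ) : ℚ) * c ≠ 0 := mul_ne_zero hu0 hc0
  have hval := congrArg (padicValRat p) hc'
  rw [padicValRat.pow, padicValRat.mul hΔC (pow_ne_zero _ huc0), padicValRat.pow] at hval
  have hvW : padicValRat p W.Δ = padicValInt p W.minimalDiscriminantInt := by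
    rw [← cast_minimalDiscriminantInt, padicValRat.of_int]
  have hvC : padicValRat p (C • W'').Δ = padicValInt p (C • W'').minimalDiscriminantInt := by
    rw [← cast_minimalDiscriminantInt, padicValRat.of_int]
  rw [hvW, hvC, hsib] at hval
  rw [Int.modEq_iff_dvd]
  refine ⟨-padicValRat p (((C.u : ℚˣ) : ℚ) * c), ?_⟩
  push_cast at hval ⊢
  linarith

end Isogeny

end WeierstrassCurve

namespace Literature.NumberTheory.EllipticCurves

open _root_.WeierstrassCurve

/-- `p² ≡ 1 (mod 12)` for a prime `p ≥ 5` (`p` is prime to `6`, so `p ≡ ±1, ±5 (mod 12)`).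
[folklore] -/
private theorem sq_modEq_one_twelve {p : ℕ} (hp : p.Prime) (hp5 : 5 ≤ p) :
    (p : ℤ) ^ 2 ≡ 1 [ZMOD 12] := by
  have h2 : ¬ 2 ∣ p := fun h ↦ by
    have := (Nat.prime_dvd_prime_iff_eq Nat.prime_two hp).mp h; omega
  have h3 : ¬ 3 ∣ p := fun h ↦ by
    have := (Nat.prime_dvd_prime_iff_eq Nat.prime_three hp).mp h; omega
  have hr : p % 12 = 1 ∨ p % 12 = 5 ∨ p % 12 = 7 ∨ p % 12 = 11 := by omega
  have hpr : (p : ℤ) ≡ ((p % 12 : ℕ) : ℤ) [ZMOD 12] := by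
    rw [Int.ModEq]; push_cast; simp [Int.emod_emod_of_dvd]
  have key := hpr.pow 2
  refine key.trans ?_
  rcases hr with h | h | h | h <;> rw [h] <;> decide

/-- **The pointwise exponent is `1` or `p` modulo `12`**: `pˢ ≡ 1` or `pˢ ≡ p (mod 12)` for a prime
`p ≥ 5` (since `p² ≡ 1`). [folklore] -/
private theorem pow_modEq_one_or_self_twelve {p : ℕ} (hp : p.Prime) (hp5 : 5 ≤ p) (s : ℕ) :
    (p : ℤ) ^ s ≡ 1 [ZMOD 12] ∨ (p : ℤ) ^ s ≡ (p : ℤ) [ZMOD 12] := by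
  induction s with
  | zero => exact Or.inl (by rw [pow_zero])
  | succ s ih =>
    rcases ih with h | h
    · right
      calc (p : ℤ) ^ (s + 1) = (p : ℤ) ^ s * p := pow_succ _ _
        _ ≡ 1 * p [ZMOD 12] := h.mul_right _
        _ = p := one_mul _
    · left
      calc (p : ℤ) ^ (s + 1) = (p : ℤ) ^ s * p := pow_succ _ _
        _ ≡ p * p [ZMOD 12] := h.mul_right _
        _ = (p : ℤ) ^ 2 := (sq _).symm
        _ ≡ 1 [ZMOD 12] := sq_modEq_one_twelve hp hp5

/-- **Dokchitser–Dokchitser's congruence for an ARBITRARY `ℚ`-isogeny at a potentially good prime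
`p ≥ 5`, dichotomy form**: for globally minimal `W ∼ W'` with `0 ≤ ord_p j(W)`,
`ord_p Δ_min(W') ≡ ord_p Δ_min(W) (mod 12)` OR `ord_p Δ_min(W') ≡ p · ord_p Δ_min(W) (mod 12)`
(from `∃ s, pˢ·δ ≡ δ'` and `p² ≡ 1 (mod 12)`). With `e = 12 / gcd(12, ord_p Δ_min)`: if `e ∣ p − 1`
(type (G)) the two alternatives agree; if `e ∣ p + 1`, `e ∤ p − 1` (the potentially supersingular
locus) the second is the Kodaira swap `δ' ≡ −δ` of op. cit. Cor. 8 / Table 1.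
[cite: DokchitserDokchitser2015LocalInvariants, §3 Thm. 6 and Cor. 8, Table 1] -/
theorem padicValInt_minimalDiscriminantInt_modEq_or_modEq_mul_of_isIsogenous
    {W W' : WeierstrassCurve ℚ} [W.IsElliptic] [W'.IsElliptic] [W.IsGloballyMinimal]
    [W'.IsGloballyMinimal] (hiso : IsIsogenous W W') {p : ℕ} (hp : p.Prime) (hp5 : 5 ≤ p)
    (hj : 0 ≤ padicValRat p W.j) :
    (padicValInt p W'.minimalDiscriminantInt : ℤ) ≡
        (padicValInt p W.minimalDiscriminantInt : ℤ) [ZMOD 12] ∨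
      (padicValInt p W'.minimalDiscriminantInt : ℤ) ≡
        (p : ℤ) * (padicValInt p W.minimalDiscriminantInt : ℤ) [ZMOD 12] := by
  obtain ⟨s, hs⟩ :=
    exists_pow_mul_padicValInt_minimalDiscriminantInt_modEq_twelve_of_isIsogenous hiso hp hp5 hj
  rcases pow_modEq_one_or_self_twelve hp hp5 s with h | h
  · left
    have := (h.mul_right (padicValInt p W.minimalDiscriminantInt : ℤ)).symm.trans hs
    rw [one_mul] at this
    exact this.symm
  · right
    exact ((h.mul_right (padicValInt p W.minimalDiscriminantInt : ℤ)).symm.trans hs).symm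

end Literature.NumberTheory.EllipticCurves

end
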